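import Literature.AlgebraicGeometry.Resolution.MacaulayficationOverCMLocus
import Literature.AlgebraicGeometry.Resolution.ComponentGluing
import Literature.AlgebraicGeometry.Resolution.CohenMacaulaySystemsOfParameters
import Summits.ResolutionOfSingularities.ResolutionOfSingularities.Theorems.FrobeniusLadderFInjectiveMacaulayficationIsoLocusTransport
import Mathlib.RingTheory.RegularLocalRing.Defs
import Mathlib.AlgebraicGeometry.FunctionField
import HarnessLib

/-!
# PF_CM for integral `X`: Macaulayfication over the codimension-≥-4 residue keeping regularity off it (line U of the crux
# `FInjectiveMacaulayfication` stmt-ResolutionOfSingularities-15315, chain w45a; res-L1-w45a-plan-1 R15.31 (2) «stub-2 NEXT = PF_CM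
# `CMOverCodimFourResidue` via the named fact `CesnaviciusMacaulayfication`»; statement = res-L1-w45a-strat-1's `ULine.lean` v1.5
# `a49f5b3dbd3e00e6` decl `UReduction.CMOverCodimFourResidue` with `IsIntegral X` for `IsReduced X` (the reduced sibling needs component
# separation, as for stub-3's U1 `…RegularOffCodimFourResidue` p557070); seat res-L1-w45a-stub-2)

[OURS · L1 W4.5a] Support file (`--supports stmt-ResolutionOfSingularities-15315 --as helper`); NOT a statement of any manuscript; CONDITIONAL on
the named fact `Literature.AlgebraicGeometry.Resolution.CesnaviciusMacaulayfication` (Česnavičius 2021 Thm. 1.6, BY NAME, hypothesis `hC`);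
no definitions; AI-written (AI review is weaker than expert review).

THE THEOREM `cmOverCodimFourResidue_integral (hC)`: for `X` INTEGRAL, separated and of finite type over a field `k`, a proper birational
reduced `π₂ : X₂ → X`, and a closed `B ⊆ X` off whose preimage `X₂` is regular, there is a proper birational `π₃ : X₃ → X₂` with `X₃`
reduced (indeed integral), every stalk of `X₃` a Cohen–Macaulay domain (ULine's `CMStalks`, unfolded), and `X₃` still regular off the
preimage of `B`. PROOF: `X₂` is integral (reduced, and irreducible by birationality over the integral `X`,
`ComponentGluing.IsBirational.irreducibleSpace`); apply `CesnaviciusMacaulayfication` to `X₂ → Spec k`; its isomorphism clause applies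
to the open `U := π₂⁻¹(X ∖ B)`, whose stalks are regular hence Cohen–Macaulay (`cmClause_of_isRegularLocalRing`), so over `U` the stalks
of `X₃` are those of `X₂` (tree `IsoLocusTransport.nonempty_stalkRingEquiv_of_isIso_morphismRestrict`), regular. (The codimension hypothesis on `B` is not used.)

[cite: Cesnavicius2021, Thm. 1.6]
-/

-- single-problem summit: the doubled namespace component is forced
set_option linter.dupNamespace false

noncomputable section

namespace Summit.ResolutionOfSingularities.ResolutionOfSingularities.Theorems.FInjectiveMacaulayfication.CMOverCodimFourResidue

open CategoryTheory CategoryTheory.Limits AlgebraicGeometry TopologicalSpace Opposite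
open Literature.AlgebraicGeometry.Resolution
open Summit.ResolutionOfSingularities.ResolutionOfSingularities.Theorems.FInjectiveMacaulayfication

/-- A reduced scheme birational over an integral scheme is integral. [folklore] -/
theorem isIntegral_of_isBirational {X X₂ : Scheme.{0}} [IsIntegral X] (π₂ : X₂ ⟶ X) (hbir : IsBirational π₂) [IsReduced X₂] :
    IsIntegral X₂ := by
  haveI : IrreducibleSpace X₂ := ComponentGluing.IsBirational.irreducibleSpace hbir
  exact isIntegral_of_irreducibleSpace_of_isReduced X₂

/-- **PF_CM for integral `X`** (ULine v1.5 `CMOverCodimFourResidue` with `IsIntegral X`; conditional on Česnavičius 2021 Thm. 1.6 BY NAME):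
a proper birational reduced model `X₂ → X`, regular off the preimage of a closed `B ⊆ X`, admits a proper birational `X₃ → X₂` with `X₃`
reduced, all stalks Cohen–Macaulay domains, and regular off the preimage of `B`. [OURS · conditional-result] [cite: Cesnavicius2021, Thm. 1.6] -/
theorem cmOverCodimFourResidue_integral (hC : CesnaviciusMacaulayfication.{0}) :
    ∀ (k : Type) [Field k] (X : Scheme.{0}) (f : X ⟶ Spec (.of k)),
      IsSeparated f → LocallyOfFiniteType f → QuasiCompact f → IsIntegral X →
      ∀ (X₂ : Scheme.{0}) (π₂ : X₂ ⟶ X), IsProper π₂ → IsBirational π₂ → IsReduced X₂ →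
      ∀ B : Set X, IsClosed B → (∀ b ∈ B, (4 : WithBot ℕ∞) ≤ ringKrullDim (X.presheaf.stalk b)) →
        (∀ x₂ : X₂, π₂.base x₂ ∉ B → IsRegularLocalRing (X₂.presheaf.stalk x₂)) →
        ∃ (X₃ : Scheme.{0}) (π₃ : X₃ ⟶ X₂), IsProper π₃ ∧ IsBirational π₃ ∧ IsReduced X₃ ∧
          (∀ x : X₃, IsDomain (X₃.presheaf.stalk x) ∧ ∀ d : ℕ, ringKrullDim (X₃.presheaf.stalk x) = d →
            ∀ s : Fin d → X₃.presheaf.stalk x, (Ideal.span (Set.range s)).radical.IsMaximal →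
              RingTheory.Sequence.IsWeaklyRegular (X₃.presheaf.stalk x) (List.ofFn s)) ∧
          ∀ x₃ : X₃, π₂.base (π₃.base x₃) ∉ B → IsRegularLocalRing (X₃.presheaf.stalk x₃) := by
  intro k _ X f hsep hft hqc hint X₂ π₂ hprop hbir hred B hB _hB4 hreg
  haveI := hsep
  haveI := hft
  haveI := hqc
  haveI := hprop
  haveI : IsIntegral X₂ := isIntegral_of_isBirational π₂ hbir
  -- Česnavičius' Macaulayfication of `X₂ → Spec k`
  obtain ⟨X₃, π₃, hprop₃, hbir₃, hint₃, hCM, hIso⟩ :=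
    hC k X₂ (π₂ ≫ f) inferInstance inferInstance inferInstance inferInstance
  haveI := hint₃
  refine ⟨X₃, π₃, hprop₃, hbir₃, inferInstance, fun x => ⟨inferInstance, hCM x⟩, fun x₃ hx₃ => ?_⟩
  -- over `U := π₂⁻¹(X ∖ B)` the stalks of `X₂` are regular, hence Cohen–Macaulay, so `π₃ ∣_ U` is an isomorphism
  let U : X₂.Opens := π₂ ⁻¹ᵁ ⟨Bᶜ, hB.isOpen_compl⟩
  have hU : ∀ x : X₂, x ∈ U → ∀ d : ℕ, ringKrullDim (X₂.presheaf.stalk x) = d →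
      ∀ s : Fin d → X₂.presheaf.stalk x, (Ideal.span (Set.range s)).radical.IsMaximal →
        RingTheory.Sequence.IsWeaklyRegular (X₂.presheaf.stalk x) (List.ofFn s) := by
    intro x hx
    haveI : IsRegularLocalRing (X₂.presheaf.stalk x) := hreg x hx
    exact cmClause_of_isRegularLocalRing (X₂.presheaf.stalk x)
  haveI : IsIso (π₃ ∣_ U) := hIso U hU
  haveI : IsRegularLocalRing (X₂.presheaf.stalk (π₃.base x₃)) := hreg _ hx₃
  obtain ⟨e⟩ := IsoLocusTransport.nonempty_stalkRingEquiv_of_isIso_morphismRestrict π₃ U x₃ hx₃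
  exact IsRegularLocalRing.of_ringEquiv e

end Summit.ResolutionOfSingularities.ResolutionOfSingularities.Theorems.FInjectiveMacaulayfication.CMOverCodimFourResidue

end
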